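import Literature.AlgebraicGeometry.Modules.FrameTransition
import Literature.AlgebraicGeometry.Modules.SheafHomFunctor
import Literature.AlgebraicGeometry.Modules.MatrixCocycleFrame
import HarnessLib

/-!
# Frames of `E^∨` and of `𝓗om(F, G)` from frames of `E`, `F`, `G`

For `𝒪_X`-modules on a scheme `X` trivialised over an open `W` by frames
`e : 𝒪^I ≅ E|_W`, `f : 𝒪^J ≅ F|_W`, `w : 𝒪^K ≅ G|_W` (`I`, `J`, `K` finite; basis sections `b_i`,
dual basis `λ_i`, coordinates — `Modules/LocalFrames.lean`, `Modules/FrameTransition.lean`):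

* `dualFrame e : 𝒪^I ≅ E^∨|_W` — **the dual frame**, with basis sections the dual basis
  `λ_i ∈ Γ(E^∨, W)` (`basisSection_dualFrame`) and coordinates `μ ↦ μ(b_i)`
  (`dualBasis_dualFrame`, `coord_dualFrame`): Hartshorne II Ex. 5.1 (b) for `E^∨ = 𝓗om(E, 𝒪_X)`;
* `homFrame f w : 𝒪^{J × K} ≅ 𝓗om(F, G)|_W` — **the frame of `𝓗om(F, G)` by the "matrix units"**
  `β_{(j,k)} = λ^f_j ⊗ g_k : s ↦ λ^f_j(s) g_k` (`homBasis`, `basisSection_homFrame`), with coordinates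
  `ψ ↦ λ^w_k(ψ(b^f_j))` (`dualBasis_homFrame`, `coord_homFrame`): Hartshorne II Ex. 5.1 (b)
  (`𝓗om(F, G) ≅ F^∨ ⊗ G` for `F` locally free of finite rank);
* `twistFrame e w : 𝒪^{I × K} ≅ 𝓗om(E^∨, G)|_W` — the frame of the tree's model `𝓗om(E^∨, G)` of
  `E ⊗ G` (`HodgeTheory.twistCotangent`, `HodgeTheory.twistHodge`) by the sections
  `e_i ⊗ g_k : μ ↦ μ(b_i) g_k` (`twistBasis`, `basisSection_twistFrame`), with coordinates
  `φ ↦ λ^w_k(φ(λ_i))` (`coord_twistFrame`); consequently `isFiniteLocallyFree_sheafHom_dual`.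

All frames are built as in `Modules/MatrixCocycleFrame.lean`: the morphism out of the free module is
given by the basis sections (Mathlib `SheafOfModules.freeHomEquiv`), the inverse by the coordinate
morphisms, and the two identities are the basis expansions of `Modules/LocalFrames.lean`
(`eq_sum_smul_dualBasis`, `eq_sum_coord_smul`) over every open below `W`. Everything is proved; no
named facts.

## References

* R. Hartshorne, *Algebraic Geometry*, GTM 52 (1977), II Ex. 5.1 (a) `E^∨∨ ≅ E`, (b)
  `𝓗om(E, F) ≅ E^∨ ⊗ F` for `E` locally free of finite rank (p. 123; held copy PDF p. 156). [Hartshorne1977]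
-/

set_option backward.isDefEq.respectTransparency false

noncomputable section

open CategoryTheory AlgebraicGeometry Opposite TopologicalSpace Limits

namespace Literature.AlgebraicGeometry.Modules

open Literature.AlgebraicGeometry.Motives

universe u

variable {X : Scheme.{u}}

open scoped Classical

/-! ### Generalities: maps out of a free module given by sections -/

section Free

variable {M : X.Modules} {W V : X.Opens} {I : Type u}

/-- The `i`-th component of the map `𝒪^I → M|_W` defined by sections `m_i ∈ Γ(M, W)` is
`r ↦ r • m_i|`. [folklore] -/
private lemma ιFree_comp_freeHomEquiv_symm_eq_smulSection (m : I → Γ(M, W)) (i : I) :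
    SheafOfModules.ιFree i ≫ (M.over W).freeHomEquiv.symm
        (fun i => (Scheme.Modules.overSectionsEquiv M W).symm (m i)) = smulSection (m i) := by
  rw [← SheafOfModules.unitHomEquiv_symm_freeHomEquiv_apply, Equiv.apply_symm_apply]
  exact hom_ext_of_appLE (E := unitModule X) (M := M) (U := W) fun V l r => by
    rw [appLE_smulSection]
    rfl

/-- Basis sections of a frame whose underlying map is defined by sections `m_i`. [folklore] -/
private lemma basisSection_eq_of_hom_eq {E : X.Modules} (e : SheafOfModules.free I ≅ E.over W)
    (m : I → Γ(E, W))
    (h : e.hom = (E.over W).freeHomEquiv.symm fun i => (Scheme.Modules.overSectionsEquiv E W).symm (m i))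
    (i : I) : basisSection e i = m i := by
  rw [basisSection, h, Equiv.apply_symm_apply, Equiv.apply_symm_apply]

variable [Fintype I]

/-- A morphism into `𝒪^I` built from "coordinate" maps `c_i : N → 𝒪` is a left inverse of the map
`h : 𝒪^I → N` as soon as `(ι_j ≫ h) ≫ c_i = δ_{ij}` (`Modules/MatrixCocycleFrame.lean`, abstract form).
[folklore] -/
private lemma comp_sum_comp_ιFree_eq_id {N : SheafOfModules.{u} (X.ringCatSheaf.over W)}
    (h : SheafOfModules.free I ⟶ N) (c : I → (N ⟶ SheafOfModules.unit _))
    (hA : ∀ j, (SheafOfModules.ιFree j ≫ h) ≫ c j = 𝟙 _)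
    (hB : ∀ j k, j ≠ k → (SheafOfModules.ιFree j ≫ h) ≫ c k = 0) :
    h ≫ ∑ i, c i ≫ SheafOfModules.ιFree i = 𝟙 _ := by
  refine Cofan.IsColimit.hom_ext (SheafOfModules.isColimitFreeCofan I) _ _ fun j => ?_
  rw [SheafOfModules.freeCofan_inj]
  have h' := MatrixCocycle.comp_sum_comp_ιFree_eq (fun j => SheafOfModules.ιFree j ≫ h) c hA hB j
  exact (Category.assoc _ _ _).symm.trans (h'.trans (Category.comp_id _).symm)

end Free

/-! ### The dual frame `𝒪^I ≅ E^∨|_W` -/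

section Dual

variable {E : X.Modules} {W V : X.Opens} {I : Type u} (e : SheafOfModules.free I ≅ E.over W)

/-- The dual basis section `λ_i` as an element of `Γ(E^∨, W)`. [folklore] -/
abbrev dualBasisSection (i : I) : Γ(dual E, W) :=
  ((dualBasis e i : E.over W ⟶ (unitModule X).over W) : Γ(dual E, W))

/-- Restricting the dual basis section: `λ_i|_V` is the dual basis of the restricted frame `e|_V`
(the dual basis is compatible with restriction). [cite: Hartshorne1977, II Ex. 5.1 (b)] -/
lemma map_dualBasisSection (k : V ⟶ W) (i : I) :
    (dual E).presheaf.map k.op (dualBasisSection e i) =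
      dualBasisSection (SheafOfModules.restrictTrivialisation (R := X.ringCatSheaf) k e) i := by
  change restrictHom k (dualBasis e i) = _
  rw [restrictHom_dualBasis]

/-- The morphism `𝒪^I → E^∨|_W` sending the `i`-th basis vector to the dual basis section `λ_i`.
[folklore] -/
def dualFrameHom : SheafOfModules.free I ⟶ (dual E).over W :=
  ((dual E).over W).freeHomEquiv.symm fun i =>
    (Scheme.Modules.overSectionsEquiv (dual E) W).symm (dualBasisSection e i)

/-- On the `i`-th copy of `𝒪`, `dualFrameHom` is `r ↦ r • λ_i|`. [folklore] -/
private lemma ιFree_comp_dualFrameHom (i : I) :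
    SheafOfModules.ιFree i ≫ dualFrameHom e = smulSection (dualBasisSection e i) :=
  ιFree_comp_freeHomEquiv_symm_eq_smulSection _ i

/-- `r • λ_j|_V` evaluated at `b_i|_V` is `δ_{ij} r`. [folklore] -/
private lemma appLE_smul_map_dualBasisSection (k : V ⟶ W) (r : Γ(X, V)) (i j : I) :
    appLE ((r • (dual E).presheaf.map k.op (dualBasisSection e j) : Γ(dual E, V)) :
        E.over V ⟶ (unitModule X).over V) (𝟙 V) (E.presheaf.map k.op (basisSection e i)) =
      if j = i then r else 0 := by
  rw [map_dualBasisSection]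
  change appLE (r • dualBasis (SheafOfModules.restrictTrivialisation (R := X.ringCatSheaf) k e) j)
    (𝟙 V) _ = _
  rw [appLE_smul_id, ← basisSection_restrictTrivialisation, appLE_dualBasis_basisSection]
  by_cases hji : j = i
  · subst hji
    rw [if_pos rfl, if_pos rfl]
    change r * 1 = r
    exact mul_one r
  · rw [if_neg (Ne.symm hji), if_neg hji]
    change r * 0 = 0
    exact mul_zero r

variable [Fintype I]

/-- The morphism `E^∨|_W → 𝒪^I`, `μ ↦ (μ(b_i))_i` (evaluation on the basis sections). [folklore] -/
def dualFrameInv : (dual E).over W ⟶ SheafOfModules.free I :=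
  ∑ i, evalAt (M := unitModule X) (basisSection e i) ≫ SheafOfModules.ιFree i

omit [Fintype I] in
/-- `λ_j ↦ λ_j(b_i) = δ_{ij}`: the composite `𝒪 → E^∨|_W → 𝒪` of the `j`-th basis map and the
`i`-th evaluation. [folklore] -/
private lemma ιFree_comp_dualFrameHom_comp_evalAt (i j : I) :
    (SheafOfModules.ιFree j ≫ dualFrameHom e) ≫ evalAt (M := unitModule X) (basisSection e i) =
      if j = i then 𝟙 _ else 0 := by
  rw [ιFree_comp_dualFrameHom]
  refine hom_ext_of_appLE (E := unitModule X) (M := unitModule X) (U := W) fun V k r => ?_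
  rw [appLE_comp, appLE_smulSection, appLE_evalAt]
  have h := appLE_smul_map_dualBasisSection e k r i j
  refine h.trans ?_
  by_cases hji : j = i
  · rw [if_pos hji, if_pos hji]
    rfl
  · rw [if_neg hji, if_neg hji]
    rfl

/-- `dualFrameHom ≫ dualFrameInv = 𝟙`. [folklore] -/
private lemma dualFrameHom_comp_dualFrameInv : dualFrameHom e ≫ dualFrameInv e = 𝟙 _ :=
  comp_sum_comp_ιFree_eq_id _ _
    (fun j => by rw [ιFree_comp_dualFrameHom_comp_evalAt, if_pos rfl])
    (fun j k hjk => by rw [ιFree_comp_dualFrameHom_comp_evalAt, if_neg hjk])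

/-- `dualFrameInv ≫ dualFrameHom = 𝟙`: every `μ ∈ Γ(E^∨, V)` is `∑_i μ(b_i|) λ_i|`
(`eq_sum_smul_dualBasis` in the restricted frame). [folklore] -/
private lemma dualFrameInv_comp_dualFrameHom : dualFrameInv e ≫ dualFrameHom e = 𝟙 _ := by
  have h : dualFrameInv e ≫ dualFrameHom e =
      ∑ i, evalAt (M := unitModule X) (basisSection e i) ≫ smulSection (dualBasisSection e i) :=
    (MatrixCocycle.sum_comp_ιFree_comp _ _).trans
      (Finset.sum_congr rfl fun i _ => by rw [ιFree_comp_dualFrameHom])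
  rw [h]
  refine hom_ext_of_appLE fun V k μ => ?_
  rw [appLE_sum, appLE_id]
  set eV := SheafOfModules.restrictTrivialisation (R := X.ringCatSheaf) k e
  have hμ := eq_sum_smul_dualBasis eV (μ : E.over V ⟶ (unitModule X).over V)
  refine (Finset.sum_congr rfl fun i _ => ?_).trans hμ.symm
  rw [appLE_comp, appLE_smulSection, map_dualBasisSection, appLE_evalAt,
    ← basisSection_restrictTrivialisation]
  rfl

/-- **The dual frame** `𝒪^I ≅ E^∨|_W` of a frame `e : 𝒪^I ≅ E|_W`, on the dual basis `λ_i`.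
[cite: Hartshorne1977, II Ex. 5.1 (b)] -/
def dualFrame : SheafOfModules.free I ≅ (dual E).over W where
  hom := dualFrameHom e
  inv := dualFrameInv e
  hom_inv_id := dualFrameHom_comp_dualFrameInv e
  inv_hom_id := dualFrameInv_comp_dualFrameHom e

/-- **The basis sections of the dual frame are the dual basis** `λ_i`. [cite: Hartshorne1977, II Ex. 5.1 (b)] -/
theorem basisSection_dualFrame (i : I) : basisSection (dualFrame e) i = dualBasisSection e i :=
  basisSection_eq_of_hom_eq _ _ rfl i

/-- **The dual basis of the dual frame is evaluation on the basis**: `λ^{∨}_i = ev_{b_i}`.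
[cite: Hartshorne1977, II Ex. 5.1 (a)] -/
theorem dualBasis_dualFrame (i : I) :
    dualBasis (dualFrame e) i = evalAt (M := unitModule X) (basisSection e i) := by
  refine hom_ext_of_basisSection (dualFrame e) fun j => ?_
  rw [appLE_dualBasis_basisSection, basisSection_dualFrame, appLE_evalAt, presheaf_map_id,
    appLE_dualBasis_basisSection]
  exact if_congr eq_comm rfl rfl

/-- **Coordinates in the dual frame are values on the basis sections**: for `μ ∈ Γ(E^∨, V)`,
`V ≤ W`, the `i`-th coordinate of `μ` in `dualFrame e` is `μ(b_i|_V)`. [cite: Hartshorne1977, II Ex. 5.1 (a)] -/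
theorem coord_dualFrame (k : V ⟶ W) (μ : E.over V ⟶ (unitModule X).over V) (i : I) :
    coord (dualFrame e) k (μ : Γ(dual E, V)) i =
      (appLE μ (𝟙 V) (E.presheaf.map k.op (basisSection e i)) : Γ(unitModule X, V)) := by
  rw [coord_def, dualBasis_dualFrame, appLE_evalAt]

/-- Hence `E^∨` is finite locally free when `E` is. [cite: Hartshorne1977, II Ex. 5.1 (b)] -/
theorem isFiniteLocallyFree_dual (hE : IsFiniteLocallyFree E) : IsFiniteLocallyFree (dual E) := by
  intro x
  obtain ⟨U, hxU, I, hI, ⟨e⟩⟩ := hE x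
  haveI := Fintype.ofFinite I
  exact ⟨U, hxU, I, hI, ⟨dualFrame e⟩⟩

end Dual

/-! ### The frame `𝒪^{J × K} ≅ 𝓗om(F, G)|_W` by matrix units -/

section Hom

variable {F G : X.Modules} {W V : X.Opens} {J K : Type u}
  (f : SheafOfModules.free J ≅ F.over W) (w : SheafOfModules.free K ≅ G.over W)

/-- **The matrix units** `β_{(j,k)} = λ^f_j ⊗ g_k : F|_W → G|_W`, `s ↦ λ^f_j(s) g_k`. [folklore] -/
def homBasis (jk : J × K) : F.over W ⟶ G.over W :=
  dualBasis f jk.1 ≫ smulSection (basisSection w jk.2)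

/-- Values of the matrix units: `β_{(j,k)}(s) = λ_j(s) g_k|`. [cite: Hartshorne1977, II Ex. 5.1 (b)] -/
lemma appLE_homBasis (jk : J × K) (k' : V ⟶ W) (s : Γ(F, V)) :
    appLE (homBasis f w jk) k' s = coord f k' s jk.1 • G.presheaf.map k'.op (basisSection w jk.2) := by
  rw [homBasis, appLE_comp, appLE_smulSection, coord_def]

/-- `β_{(j,k)}` on the restricted basis section `b_i|`: `δ_{ij} g_k|`. [cite: Hartshorne1977, II Ex. 5.1 (b)] -/
lemma appLE_homBasis_map_basisSection (jk : J × K) (k' : V ⟶ W) (i : J) :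
    appLE (homBasis f w jk) k' (F.presheaf.map k'.op (basisSection f i)) =
      if i = jk.1 then G.presheaf.map k'.op (basisSection w jk.2) else 0 := by
  rw [appLE_homBasis, coord_map_basisSection]
  split_ifs
  · exact one_smul _ _
  · exact zero_smul _ _

/-- The matrix unit as a section of `𝓗om(F, G)` over `W`. [folklore] -/
abbrev homBasisSection (jk : J × K) : Γ(sheafHom F G, W) :=
  ((homBasis f w jk : F.over W ⟶ G.over W) : Γ(sheafHom F G, W))

/-- The morphism `𝒪^{J × K} → 𝓗om(F, G)|_W` sending the basis vectors to the matrix units. [folklore] -/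
def homFrameHom : SheafOfModules.free (J × K) ⟶ (sheafHom F G).over W :=
  ((sheafHom F G).over W).freeHomEquiv.symm fun jk =>
    (Scheme.Modules.overSectionsEquiv (sheafHom F G) W).symm (homBasisSection f w jk)

/-- On the `(j,k)`-th copy of `𝒪`, `homFrameHom` is `r ↦ r • β_{(j,k)}|`. [folklore] -/
private lemma ιFree_comp_homFrameHom (jk : J × K) :
    SheafOfModules.ιFree jk ≫ homFrameHom f w = smulSection (homBasisSection f w jk) :=
  ιFree_comp_freeHomEquiv_symm_eq_smulSection _ jk

/-- **The coordinate morphisms** `𝓗om(F, G)|_W → 𝒪|_W`, `ψ ↦ λ^w_k(ψ(b^f_j))`. [folklore] -/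
def homCoord (jk : J × K) : (sheafHom F G).over W ⟶ (unitModule X).over W :=
  evalAt (M := G) (basisSection f jk.1) ≫ dualBasis w jk.2

/-- Values of the coordinate morphisms: `ψ ↦ λ^w_k(ψ(b^f_j|))`. [cite: Hartshorne1977, II Ex. 5.1 (b)] -/
lemma appLE_homCoord (jk : J × K) (k' : V ⟶ W) (ψ : F.over V ⟶ G.over V) :
    (appLE (homCoord f w jk) k' (ψ : Γ(sheafHom F G, V)) : Γ(unitModule X, V)) =
      coord w k' (appLE ψ (𝟙 V) (F.presheaf.map k'.op (basisSection f jk.1))) jk.2 := by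
  rw [homCoord, appLE_comp, appLE_evalAt, coord_def]

/-- `r • β_{(j,l)}|_V` has `(i,k)`-coordinate `δ r`. [folklore] -/
private lemma appLE_homCoord_smul_map_homBasisSection (ik jl : J × K) (k' : V ⟶ W) (r : Γ(X, V)) :
    (appLE (homCoord f w ik) k' (r • (sheafHom F G).presheaf.map k'.op (homBasisSection f w jl)) :
        Γ(unitModule X, V)) = if jl = ik then r else 0 := by
  rw [appLE_smul_right, appLE_homCoord]
  change r * coord w k' (appLE (restrictHom k' (homBasis f w jl)) (𝟙 V)
    (F.presheaf.map k'.op (basisSection f ik.1))) ik.2 = _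
  rw [appLE_restrictHom, Subsingleton.elim (𝟙 V ≫ k') k', appLE_homBasis_map_basisSection]
  obtain ⟨i, k⟩ := ik
  obtain ⟨j, l⟩ := jl
  simp only [Prod.mk.injEq]
  by_cases hij : i = j
  · subst hij
    rw [if_pos rfl, coord_map_basisSection]
    by_cases hkl : l = k
    · subst hkl
      simp only [and_self, if_true, mul_one]
    · rw [if_neg hkl, mul_zero, if_neg (fun h => hkl h.2)]
  · rw [if_neg hij, coord_zero, mul_zero, if_neg (fun h => hij h.1.symm)]

variable [Fintype J] [Fintype K]

/-- The morphism `𝓗om(F, G)|_W → 𝒪^{J × K}` of all coordinates. [folklore] -/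
def homFrameInv : (sheafHom F G).over W ⟶ SheafOfModules.free (J × K) :=
  ∑ jk, homCoord f w jk ≫ SheafOfModules.ιFree jk

omit [Fintype J] [Fintype K] in
/-- `(ι_{jl} ≫ homFrameHom) ≫ homCoord_{ik} = δ`. [folklore] -/
private lemma ιFree_comp_homFrameHom_comp_homCoord (ik jl : J × K) :
    (SheafOfModules.ιFree jl ≫ homFrameHom f w) ≫ homCoord f w ik = if jl = ik then 𝟙 _ else 0 := by
  rw [ιFree_comp_homFrameHom]
  refine hom_ext_of_appLE (E := unitModule X) (M := unitModule X) (U := W) fun V k' r => ?_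
  rw [appLE_comp, appLE_smulSection]
  refine (appLE_homCoord_smul_map_homBasisSection f w ik jl k' r).trans ?_
  by_cases h : jl = ik
  · rw [if_pos h, if_pos h]
    rfl
  · rw [if_neg h, if_neg h]
    rfl

/-- `homFrameHom ≫ homFrameInv = 𝟙`. [folklore] -/
private lemma homFrameHom_comp_homFrameInv : homFrameHom f w ≫ homFrameInv f w = 𝟙 _ :=
  comp_sum_comp_ιFree_eq_id _ _
    (fun jk => by rw [ιFree_comp_homFrameHom_comp_homCoord, if_pos rfl])
    (fun jk il h => by rw [ιFree_comp_homFrameHom_comp_homCoord, if_neg h])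

/-- **Expansion in matrix units**: `ψ = ∑_{j,k} λ^w_k(ψ(b_j|)) β_{(j,k)}|` for `ψ : F|_V → G|_V`, `V ≤ W`.
[cite: Hartshorne1977, II Ex. 5.1 (b)] -/
theorem eq_sum_coord_smul_homBasis (k' : V ⟶ W) (ψ : F.over V ⟶ G.over V) :
    ψ = ∑ jk : J × K, (coord w k' (appLE ψ (𝟙 V) (F.presheaf.map k'.op (basisSection f jk.1))) jk.2) •
      restrictHom k' (homBasis f w jk) := by
  set fV := SheafOfModules.restrictTrivialisation (R := X.ringCatSheaf) k' f
  refine hom_ext_of_basisSection fV fun j₀ => ?_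
  rw [appLE_sum, basisSection_restrictTrivialisation]
  have hterm : ∀ jk : J × K,
      appLE ((coord w k' (appLE ψ (𝟙 V) (F.presheaf.map k'.op (basisSection f jk.1))) jk.2) •
          restrictHom k' (homBasis f w jk)) (𝟙 V) (F.presheaf.map k'.op (basisSection f j₀)) =
        if j₀ = jk.1 then
          coord w k' (appLE ψ (𝟙 V) (F.presheaf.map k'.op (basisSection f jk.1))) jk.2 •
            G.presheaf.map k'.op (basisSection w jk.2) else 0 := by
    intro jk
    rw [appLE_smul_id, appLE_restrictHom, Subsingleton.elim (𝟙 V ≫ k') k',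
      appLE_homBasis_map_basisSection]
    split_ifs
    · rfl
    · exact smul_zero _
  rw [Finset.sum_congr rfl fun jk _ => hterm jk, Fintype.sum_prod_type, Finset.sum_eq_single j₀]
  · simp only [if_true]
    exact eq_sum_coord_smul w k' _
  · intro j _ hj
    exact Finset.sum_eq_zero fun k _ => if_neg (Ne.symm hj)
  · exact fun h => absurd (Finset.mem_univ j₀) h

/-- `homFrameInv ≫ homFrameHom = 𝟙` (the expansion in matrix units). [folklore] -/
private lemma homFrameInv_comp_homFrameHom : homFrameInv f w ≫ homFrameHom f w = 𝟙 _ := by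
  have h : homFrameInv f w ≫ homFrameHom f w =
      ∑ jk, homCoord f w jk ≫ smulSection (homBasisSection f w jk) :=
    (MatrixCocycle.sum_comp_ιFree_comp _ _).trans
      (Finset.sum_congr rfl fun jk _ => by rw [ιFree_comp_homFrameHom])
  rw [h]
  refine hom_ext_of_appLE fun V k' ψ => ?_
  rw [appLE_sum, appLE_id]
  have hψ := eq_sum_coord_smul_homBasis f w k' (ψ : F.over V ⟶ G.over V)
  refine (Finset.sum_congr rfl fun jk _ => ?_).trans hψ.symm
  rw [appLE_comp, appLE_smulSection, appLE_homCoord]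
  rfl

/-- **The frame `𝒪^{J × K} ≅ 𝓗om(F, G)|_W` by matrix units** of frames `f` of `F|_W` and `w` of `G|_W`.
[cite: Hartshorne1977, II Ex. 5.1 (b)] -/
def homFrame : SheafOfModules.free (J × K) ≅ (sheafHom F G).over W where
  hom := homFrameHom f w
  inv := homFrameInv f w
  hom_inv_id := homFrameHom_comp_homFrameInv f w
  inv_hom_id := homFrameInv_comp_homFrameHom f w

/-- **The basis sections of `homFrame` are the matrix units.** [cite: Hartshorne1977, II Ex. 5.1 (b)] -/
theorem basisSection_homFrame (jk : J × K) : basisSection (homFrame f w) jk = homBasisSection f w jk :=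
  basisSection_eq_of_hom_eq _ _ rfl jk

/-- **The dual basis of `homFrame` is given by the coordinate morphisms** `ψ ↦ λ^w_k(ψ(b_j))`.
[cite: Hartshorne1977, II Ex. 5.1 (b)] -/
theorem dualBasis_homFrame (jk : J × K) : dualBasis (homFrame f w) jk = homCoord f w jk := by
  refine hom_ext_of_basisSection (homFrame f w) fun il => ?_
  rw [appLE_dualBasis_basisSection, basisSection_homFrame]
  have h := appLE_homCoord_smul_map_homBasisSection f w jk il (𝟙 W) 1
  rw [one_smul, presheaf_map_id] at h
  refine Eq.trans ?_ h.symm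
  split_ifs <;> rfl

/-- **Coordinates in `homFrame`**: the `(j,k)`-coordinate of `ψ : F|_V → G|_V` is `λ^w_k(ψ(b_j|_V))`.
[cite: Hartshorne1977, II Ex. 5.1 (b)] -/
theorem coord_homFrame (k' : V ⟶ W) (ψ : F.over V ⟶ G.over V) (jk : J × K) :
    coord (homFrame f w) k' (ψ : Γ(sheafHom F G, V)) jk =
      coord w k' (appLE ψ (𝟙 V) (F.presheaf.map k'.op (basisSection f jk.1))) jk.2 := by
  rw [coord_def, dualBasis_homFrame, appLE_homCoord]

/-- Hence `𝓗om(F, G)` is finite locally free when `F` and `G` are (locally `𝓗om(𝒪^J, 𝒪^K) ≅ 𝒪^{J × K}`).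
[cite: Hartshorne1977, II Ex. 5.1 (b)] -/
theorem isFiniteLocallyFree_sheafHom' (hF : IsFiniteLocallyFree F) (hG : IsFiniteLocallyFree G) :
    IsFiniteLocallyFree (sheafHom F G) := by
  intro x
  obtain ⟨U, hxU, J, hJ, ⟨f⟩⟩ := hF x
  obtain ⟨U', hxU', K, hK, ⟨w⟩⟩ := hG x
  haveI := Fintype.ofFinite J
  haveI := Fintype.ofFinite K
  exact ⟨U ⊓ U', ⟨hxU, hxU'⟩, J × K, inferInstance,
    ⟨homFrame (SheafOfModules.restrictTrivialisation (R := X.ringCatSheaf) (homOfLE inf_le_left) f)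
      (SheafOfModules.restrictTrivialisation (R := X.ringCatSheaf) (homOfLE inf_le_right) w)⟩⟩

end Hom

/-! ### The frame `𝒪^{I × K} ≅ 𝓗om(E^∨, G)|_W` of the model of `E ⊗ G` -/

section Twist

variable {E G : X.Modules} {W V : X.Opens} {I K : Type u}
  (e : SheafOfModules.free I ≅ E.over W) (w : SheafOfModules.free K ≅ G.over W)

/-- **The sections `e_i ⊗ g_k`** of `𝓗om(E^∨, G)|_W`: `μ ↦ μ(b_i) g_k`. [folklore] -/
def twistBasis (ik : I × K) : (dual E).over W ⟶ G.over W :=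
  evalAt (M := unitModule X) (basisSection e ik.1) ≫ smulSection (basisSection w ik.2)

/-- `e_i ⊗ g_k` as a section of `𝓗om(E^∨, G)` over `W`. [folklore] -/
abbrev twistBasisSection (ik : I × K) : Γ(sheafHom (dual E) G, W) :=
  ((twistBasis e w ik : (dual E).over W ⟶ G.over W) : Γ(sheafHom (dual E) G, W))

variable [Fintype I] [Fintype K]

omit [Fintype K] in
/-- In the dual frame, the matrix units are the `e_i ⊗ g_k` (`E^∨∨ = E` on frames). [cite: Hartshorne1977, II Ex. 5.1 (a)] -/
lemma homBasis_dualFrame (ik : I × K) : homBasis (dualFrame e) w ik = twistBasis e w ik := by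
  rw [homBasis, dualBasis_dualFrame]
  rfl

omit [Fintype K] in
/-- Values of `e_i ⊗ g_k`: `μ ↦ μ(b_i|) g_k|`. [cite: Hartshorne1977, II Ex. 5.1 (b)] -/
lemma appLE_twistBasis (ik : I × K) (k' : V ⟶ W) (μ : E.over V ⟶ (unitModule X).over V) :
    appLE (twistBasis e w ik) k' (μ : Γ(dual E, V)) =
      coord (dualFrame e) k' (μ : Γ(dual E, V)) ik.1 • G.presheaf.map k'.op (basisSection w ik.2) := by
  rw [← homBasis_dualFrame, appLE_homBasis]

/-- **The frame `𝒪^{I × K} ≅ 𝓗om(E^∨, G)|_W`** on the sections `e_i ⊗ g_k`: the matrix-unit frame of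
the dual frame of `e` and `w`. [cite: Hartshorne1977, II Ex. 5.1 (b)] -/
def twistFrame : SheafOfModules.free (I × K) ≅ (sheafHom (dual E) G).over W :=
  homFrame (dualFrame e) w

/-- **The basis sections of `twistFrame` are the `e_i ⊗ g_k`.** [cite: Hartshorne1977, II Ex. 5.1 (b)] -/
theorem basisSection_twistFrame (ik : I × K) :
    basisSection (twistFrame e w) ik = twistBasisSection e w ik := by
  rw [twistFrame, basisSection_homFrame, homBasisSection, homBasis_dualFrame]

/-- **Coordinates in `twistFrame`**: the `(i,k)`-coordinate of `φ : E^∨|_V → G|_V` is `λ^w_k(φ(λ_i|_V))`.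
[cite: Hartshorne1977, II Ex. 5.1 (b)] -/
theorem coord_twistFrame (k' : V ⟶ W) (φ : (dual E).over V ⟶ G.over V) (ik : I × K) :
    coord (twistFrame e w) k' (φ : Γ(sheafHom (dual E) G, V)) ik =
      coord w k' (appLE φ (𝟙 V) ((dual E).presheaf.map k'.op (dualBasisSection e ik.1))) ik.2 := by
  rw [twistFrame, coord_homFrame, basisSection_dualFrame]

/-- **Expansion in the `e_i ⊗ g_k`**: `φ = ∑_{i,k} λ^w_k(φ(λ_i|)) (e_i ⊗ g_k)|` for `φ : E^∨|_V → G|_V`.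
[cite: Hartshorne1977, II Ex. 5.1 (b)] -/
theorem eq_sum_coord_smul_twistBasis (k' : V ⟶ W) (φ : (dual E).over V ⟶ G.over V) :
    φ = ∑ ik : I × K,
      (coord w k' (appLE φ (𝟙 V) ((dual E).presheaf.map k'.op (dualBasisSection e ik.1))) ik.2) •
        restrictHom k' (twistBasis e w ik) := by
  have h := eq_sum_coord_smul_homBasis (dualFrame e) w k' φ
  simp_rw [basisSection_dualFrame, homBasis_dualFrame] at h
  exact h

/-- Hence the model `𝓗om(E^∨, G)` of `E ⊗ G` is finite locally free when `E` and `G` are.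
[cite: Hartshorne1977, II Ex. 5.1 (b)] -/
theorem isFiniteLocallyFree_sheafHom_dual (hE : IsFiniteLocallyFree E) (hG : IsFiniteLocallyFree G) :
    IsFiniteLocallyFree (sheafHom (dual E) G) :=
  isFiniteLocallyFree_sheafHom' (isFiniteLocallyFree_dual hE) hG

end Twist

end Literature.AlgebraicGeometry.Modules

end
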